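import Mathlib.Tactic.Ring
import Mathlib.Tactic.LinearCombination
import Mathlib.Tactic.Linarith
import Mathlib.Tactic.Positivity
import Mathlib.Tactic.FieldSimp
import Mathlib.Data.Real.Basic
import Mathlib.Algebra.Order.Chebyshev
import Mathlib.Algebra.BigOperators.Ring.Finset
import HarnessLib

/-!
# Conjecture N on the null cone ("cross configurations"): the charge-zero class test is passed by no pure ample
# corank-one determinantal design whose roots are null-separated from a common vertex

Prover 2, generation 9, hodge-weil ladder cell (note `b2b-hweil-pv2-g9/CONJECTURE-N.md`). Companion of the charge-zero
lemma files (`WeilClassTestChargeZeroLemma*.lean`, prover 2 generation 8). Nothing here is a rung or a cited fact; pure algebra.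

SETTING (note §1–2). Real charges `u_k`, positions `A_k`, signs `ε_k = +1` (`k ∈ E`, `|E| = f+2`) / `−1` (`k ∈ F`, `|F| = f`),
centred and pure (`ΣεA²u = ΣεAu² = Σεu³ = 0`), pairwise ample at the critical charge scale (`A_e − A_f ≥ |u_e − u_f|`).
In light-cone coordinates `P = A + u`, `M = A − u` ampleness is the product order (`P_e ≥ P_f`, `M_e ≥ M_f`); with the CORNER
`P* = min_E P`, `M* = min_E M` every `F`-root satisfies `P ≤ P*`, `M ≤ M*`. Absolute corner coordinates:
`p_k = ε_k(P_k − P*) ≥ 0`, `q_k = ε_k(M_k − M*) ≥ 0`. A configuration is a CROSS (null-cone) configuration if `p_kq_k = 0` for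
all `k` (every root is null-separated from the vertex `(P*, M*)`); numerically ALL maximisers of the ratio
`R = ρ_max²(−Q₄)/Q₂` found in formats `(4,2)…(8,6)` are of this kind (note §3).

DICTIONARY for the theorems below: `u10 = Σ_k p_k`, `u01 = Σ_k q_k`, `u20 = Σ_k ε_kp_k²`, `u02 = Σ_k ε_kq_k²`,
`u30 = Σ_k p_k³`, `u03 = Σ_k q_k³` (the corner moments `Σ_k ε_k(P_k−P*)^a(M_k−M*)^b` of a cross configuration; the mixed ones
vanish), `κ` = the common value of the four central cubic `(P,M)`-moments (purity ⟺ they are equal, note Lemma 2.1); on a cross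
configuration these read `u30 = κ + (3/2)u10·u20 − u10³/2`, `u03 = κ + (3/2)u01·u02 − u01³/2`, `κ = u01(u10² − u20)/2`,
`κ = u10(u01² − u02)/2` (note Lemma 3.2), and the charge-zero class-test quantity `G₀ = Q₂ + Q₄` of
`b2b-hweil-pv2-g7/SEED-OBSTRUCTION.md` §9 equals `−(3/4)T₄ + Q` with `T₄`, `Q` the expressions displayed in
`cross_G0_identity` (note Lemma 2.2 / 3.3).
* `cross_G0_identity` — `u10·u01·G₀ = (u01²/4)(u10·u30 − u20²)` modulo the four constraint equations (`linear_combination`).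
* `sum_mul_sum_cube_sub_sq_nonneg` — `(Σp)(Σp³) − (Σεp²)² ≥ 0` for `p ≥ 0`, `ε = ±1` (Cauchy–Schwarz/Chebyshev).
* `cross_G0_nonneg` — THEOREM (Conjecture N on the null cone): for the corner moments of any pure cross configuration,
  `G₀ ≥ 0`. Hence `Q₂ + ρ_max²Q₄ ≥ 0`, i.e. `R ≤ 1`, for every pure pairwise-ample design whose critical rescaling is a cross
  configuration (note Thm 3.4; the numerical supremum over cross configurations is `R = 0.30160…`, a root of
  `2347R⁶ − 15804R⁵ + 43659R⁴ − 62937R³ + 49275R² − 19251R + 2727`, note §4).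
[cite: HardyLittlewoodPolya1952, §2.17 (Chebyshev) and Thm 7 (Cauchy)]
-/

namespace Literature.AlgebraicGeometry.HodgeTheory.WeilClassTestNullCone

open Finset BigOperators

/-- CROSS IDENTITY: on a pure cross configuration `u10·u01·G₀ = (u01²/4)·(u10·u30 − u20²)`, where
`G₀ = −(3/4)T₄ + Q` is written in the corner moments (dictionary in the module docstring). [folklore] -/
theorem cross_G0_identity (u10 u01 u20 u02 u30 u03 κ : ℝ)
    (hA : u30 = κ + 3 / 2 * u10 * u20 - 1 / 2 * u10 ^ 3)
    (hB : u03 = κ + 3 / 2 * u01 * u02 - 1 / 2 * u01 ^ 3)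
    (hC : κ = 1 / 2 * u01 * (u10 ^ 2 - u20))
    (hD : κ = 1 / 2 * u10 * (u01 ^ 2 - u02)) :
    u10 * u01 *
        (-(3 / 4) * (-(u01 / 2) * u30 - (u10 / 2) * u03
              + (3 * (u10 / 2) * (u01 / 2) - 2 * (u01 / 2) ^ 2) * u20
              + (3 * (u10 / 2) * (u01 / 2) - 2 * (u10 / 2) ^ 2) * u02
              - 6 * (u10 / 2) * (u01 / 2) * ((u10 / 2) - (u01 / 2)) ^ 2)
          + (-(1 / 4) * (u20 - 2 * (u10 / 2) ^ 2) * (u02 - 2 * (u01 / 2) ^ 2)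
              - (1 / 2) * (-2 * (u10 / 2) * (u01 / 2)) ^ 2
              + (3 / 8) * (-2 * (u10 / 2) * (u01 / 2)) * ((u20 - 2 * (u10 / 2) ^ 2) + (u02 - 2 * (u01 / 2) ^ 2))))
      = u01 ^ 2 / 4 * (u10 * u30 - u20 ^ 2) := by
  linear_combination (1 / 8 * u10 * u01 ^ 2) * hA + (3 / 8 * u10 ^ 2 * u01) * hB
    + (-(5 / 8) * u10 ^ 2 * u01 + 1 / 2 * u10 * u01 ^ 2 + 1 / 2 * u01 * u20) * hC
    + (u10 ^ 2 * u01 - 3 / 8 * u10 * u01 ^ 2 - 1 / 2 * u01 * u20) * hD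

/-- CAUCHY–SCHWARZ on one null line: `(Σ_k p_k)(Σ_k p_k³) − (Σ_k ε_kp_k²)² ≥ 0` for `p_k ≥ 0`, `ε_k = ±1`.
[cite: HardyLittlewoodPolya1952, Thm 7] -/
theorem sum_mul_sum_cube_sub_sq_nonneg {ι : Type*} [Fintype ι] (ε p : ι → ℝ)
    (hε : ∀ k, ε k = 1 ∨ ε k = -1) (hp : ∀ k, 0 ≤ p k) :
    0 ≤ (∑ k, p k) * (∑ k, p k ^ 3) - (∑ k, ε k * p k ^ 2) ^ 2 := by
  -- |Σ ε p²| ≤ Σ p²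
  have h1 : |∑ k, ε k * p k ^ 2| ≤ ∑ k, p k ^ 2 := by
    calc |∑ k, ε k * p k ^ 2| ≤ ∑ k, |ε k * p k ^ 2| := abs_sum_le_sum_abs _ _
      _ = ∑ k, p k ^ 2 := by
          refine Finset.sum_congr rfl (fun k _ => ?_)
          rcases hε k with h | h <;> simp [h, abs_of_nonneg (pow_two_nonneg (p k))]
  -- (Σ p²)² ≤ (Σ p)(Σ p³): Cauchy–Schwarz with f = p^{1/2}, g = p^{3/2}, done via the pairwise sum of squares
  have h2 : (∑ k, p k ^ 2) ^ 2 ≤ (∑ k, p k) * (∑ k, p k ^ 3) := by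
    have key : 0 ≤ ∑ i, ∑ j, p i * p j * (p i - p j) ^ 2 := by
      refine Finset.sum_nonneg (fun i _ => Finset.sum_nonneg (fun j _ => ?_))
      have := hp i; have := hp j; positivity
    have expand : ∑ i, ∑ j, p i * p j * (p i - p j) ^ 2
        = 2 * ((∑ k, p k) * (∑ k, p k ^ 3)) - 2 * (∑ k, p k ^ 2) ^ 2 := by
      have hs : ∀ i j, p i * p j * (p i - p j) ^ 2 = p i ^ 3 * p j + p i * p j ^ 3 - 2 * (p i ^ 2 * p j ^ 2) := by
        intro i j; ring
      calc ∑ i, ∑ j, p i * p j * (p i - p j) ^ 2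
          = ∑ i, ∑ j, (p i ^ 3 * p j + p i * p j ^ 3 - 2 * (p i ^ 2 * p j ^ 2)) := by
            refine Finset.sum_congr rfl (fun i _ => Finset.sum_congr rfl (fun j _ => hs i j))
        _ = ∑ i, (p i ^ 3 * (∑ j, p j) + p i * (∑ j, p j ^ 3) - 2 * (p i ^ 2 * (∑ j, p j ^ 2))) := by
            refine Finset.sum_congr rfl (fun i _ => ?_)
            rw [Finset.sum_sub_distrib, Finset.sum_add_distrib, ← Finset.mul_sum, ← Finset.mul_sum, ← Finset.mul_sum,
              ← Finset.mul_sum]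
        _ = (∑ i, p i ^ 3) * (∑ j, p j) + (∑ i, p i) * (∑ j, p j ^ 3) - 2 * ((∑ i, p i ^ 2) * (∑ j, p j ^ 2)) := by
            rw [Finset.sum_sub_distrib, Finset.sum_add_distrib, ← Finset.sum_mul, ← Finset.sum_mul, ← Finset.mul_sum,
              ← Finset.sum_mul]
        _ = 2 * ((∑ k, p k) * (∑ k, p k ^ 3)) - 2 * (∑ k, p k ^ 2) ^ 2 := by ring
    nlinarith [key, expand]
  have h3 : (∑ k, ε k * p k ^ 2) ^ 2 ≤ (∑ k, p k ^ 2) ^ 2 := by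
    have h0 : 0 ≤ ∑ k, p k ^ 2 := Finset.sum_nonneg (fun k _ => pow_two_nonneg (p k))
    exact sq_le_sq' (by linarith [neg_abs_le (∑ k, ε k * p k ^ 2), h1]) (le_trans (le_abs_self _) h1)
  linarith

/-- THEOREM (Conjecture N on the null cone). For the corner moments `u10 = Σp`, `u01 = Σq`, `u20 = Σεp²`, `u02 = Σεq²`,
`u30 = Σp³`, `u03 = Σq³` of a cross configuration (`p, q ≥ 0`, `ε = ±1`) satisfying the purity constraints (with common
central cubic moment `κ`), the charge-zero class-test quantity `G₀ = −(3/4)T₄ + Q` is `≥ 0`. [folklore] -/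
theorem cross_G0_nonneg {ι : Type*} [Fintype ι] (ε p q : ι → ℝ)
    (hε : ∀ k, ε k = 1 ∨ ε k = -1) (hp : ∀ k, 0 ≤ p k) (hq : ∀ k, 0 ≤ q k)
    (u10 u01 u20 u02 u30 u03 κ : ℝ)
    (h10 : u10 = ∑ k, p k) (h01 : u01 = ∑ k, q k) (h20 : u20 = ∑ k, ε k * p k ^ 2) (h02 : u02 = ∑ k, ε k * q k ^ 2)
    (h30 : u30 = ∑ k, p k ^ 3) (h03 : u03 = ∑ k, q k ^ 3)
    (hA : u30 = κ + 3 / 2 * u10 * u20 - 1 / 2 * u10 ^ 3)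
    (hB : u03 = κ + 3 / 2 * u01 * u02 - 1 / 2 * u01 ^ 3)
    (hC : κ = 1 / 2 * u01 * (u10 ^ 2 - u20))
    (hD : κ = 1 / 2 * u10 * (u01 ^ 2 - u02)) :
    0 ≤ -(3 / 4) * (-(u01 / 2) * u30 - (u10 / 2) * u03
              + (3 * (u10 / 2) * (u01 / 2) - 2 * (u01 / 2) ^ 2) * u20
              + (3 * (u10 / 2) * (u01 / 2) - 2 * (u10 / 2) ^ 2) * u02
              - 6 * (u10 / 2) * (u01 / 2) * ((u10 / 2) - (u01 / 2)) ^ 2)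
          + (-(1 / 4) * (u20 - 2 * (u10 / 2) ^ 2) * (u02 - 2 * (u01 / 2) ^ 2)
              - (1 / 2) * (-2 * (u10 / 2) * (u01 / 2)) ^ 2
              + (3 / 8) * (-2 * (u10 / 2) * (u01 / 2)) * ((u20 - 2 * (u10 / 2) ^ 2) + (u02 - 2 * (u01 / 2) ^ 2))) := by
  have hid := cross_G0_identity u10 u01 u20 u02 u30 u03 κ hA hB hC hD
  have hcs : 0 ≤ u10 * u30 - u20 ^ 2 := by
    rw [h10, h30, h20]; exact sum_mul_sum_cube_sub_sq_nonneg ε p hε hp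
  have h10nn : 0 ≤ u10 := by rw [h10]; exact Finset.sum_nonneg (fun k _ => hp k)
  have h01nn : 0 ≤ u01 := by rw [h01]; exact Finset.sum_nonneg (fun k _ => hq k)
  -- degenerate cases: u10 = 0 forces p = 0 (so u20 = u30 = 0); u01 = 0 forces q = 0
  rcases eq_or_lt_of_le h10nn with h0 | hpos
  · have hp0 : ∀ k, p k = 0 := by
      intro k
      have := (Finset.sum_eq_zero_iff_of_nonneg (fun i _ => hp i)).mp (by rw [← h10]; exact h0.symm) k (Finset.mem_univ k)
      exact this
    have e20 : u20 = 0 := by rw [h20]; simp [hp0]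
    have e30 : u30 = 0 := by rw [h30]; simp [hp0]
    have e10 : u10 = 0 := h0.symm
    subst e10; rw [e20, e30]
    have hκ : κ = 0 := by rw [hC]; ring_nf; rw [e20]; ring
    nlinarith [hB, hD, hκ, e20, e30]
  rcases eq_or_lt_of_le h01nn with h0' | hpos'
  · have hq0 : ∀ k, q k = 0 := by
      intro k
      exact (Finset.sum_eq_zero_iff_of_nonneg (fun i _ => hq i)).mp (by rw [← h01]; exact h0'.symm) k (Finset.mem_univ k)
    have e02 : u02 = 0 := by rw [h02]; simp [hq0]
    have e03 : u03 = 0 := by rw [h03]; simp [hq0]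
    have e01 : u01 = 0 := h0'.symm
    subst e01; rw [e02, e03]
    have hκ : κ = 0 := by rw [hC]; ring
    nlinarith [hA, hD, hκ, e02, e03]
  -- main case
  have hprod : 0 < u10 * u01 := mul_pos hpos hpos'
  have hrhs : 0 ≤ u01 ^ 2 / 4 * (u10 * u30 - u20 ^ 2) := mul_nonneg (by positivity) hcs
  by_contra hneg
  push Not at hneg
  have hlhs := mul_neg_of_pos_of_neg hprod hneg
  linarith [hid, hrhs, hlhs]


/-- THEOREM (Conjecture N on the null cone, configuration level). Let the roots of a corank-one design of format
`(f+2, f)` be given in corner form: signs `ε_k = ±1` with `Σε = 2`, absolute corner light-cone coordinates `p_k, q_k ≥ 0`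
with `p_kq_k = 0` (CROSS / null-cone configuration), vertex `(A*, u*)`, positions `A_k = A* + ε_k(p_k+q_k)/2` and charges
`u_k = u* + ε_k(p_k−q_k)/2` (so `E`-roots lie on the future null cone of the vertex, `F`-roots on the past null cone, and
the design is pairwise ample with every cross pair on a common null line binding). If the design is pure — the central
third moments `ΣεÃ²ũ`, `ΣεÃũ²`, `Σεũ³` vanish (`Ã = A − Ā`, `ũ = u − ū`, `Ā = ½ΣεA`, `ū = ½Σεu`) — then the charge-zero
class-test quantity `G₀ = Q₂ + Q₄ = ½(ΣεÃ²)(Σεũ²) + (ΣεÃũ)² − 3ΣεÃ²ũ² + 3Σεũ⁴ − (3/2)(Σεũ²)²` is `≥ 0`.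
Consequently (note Thm 3.4) `Q₂ + ρ_max²Q₄ ≥ 0` for every pure pairwise-ample real design whose critical rescaling is a
cross configuration: such designs never pass `(V)₀` strictly inside the ample range. [folklore] -/
theorem conjectureN_nullCone {ι : Type*} [Fintype ι] (ε p q A u : ι → ℝ) (As us Ab ub : ℝ)
    (hε : ∀ k, ε k = 1 ∨ ε k = -1) (hcount : ∑ k, ε k = 2)
    (hp : ∀ k, 0 ≤ p k) (hq : ∀ k, 0 ≤ q k) (hcross : ∀ k, p k * q k = 0)
    (hA : ∀ k, A k = As + ε k * (p k + q k) / 2) (hu : ∀ k, u k = us + ε k * (p k - q k) / 2)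
    (hAb : Ab = (∑ k, ε k * A k) / 2) (hub : ub = (∑ k, ε k * u k) / 2)
    (hP1 : ∑ k, ε k * (A k - Ab) ^ 2 * (u k - ub) = 0)
    (hP2 : ∑ k, ε k * (A k - Ab) * (u k - ub) ^ 2 = 0)
    (hP4 : ∑ k, ε k * (u k - ub) ^ 3 = 0) :
    0 ≤ 1 / 2 * (∑ k, ε k * (A k - Ab) ^ 2) * (∑ k, ε k * (u k - ub) ^ 2)
        + (∑ k, ε k * (A k - Ab) * (u k - ub)) ^ 2 - 3 * (∑ k, ε k * (A k - Ab) ^ 2 * (u k - ub) ^ 2)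
        + (3 * (∑ k, ε k * (u k - ub) ^ 4) - 3 / 2 * (∑ k, ε k * (u k - ub) ^ 2) ^ 2) := by
  have hε2 : ∀ k, ε k ^ 2 = 1 := fun k => by rcases hε k with h | h <;> simp [h]
  -- the signed means
  have hsumA : ∑ k, ε k * A k = 2 * As + ((∑ k, p k) + (∑ k, q k)) / 2 := by
    have h : ∀ k ∈ Finset.univ, ε k * A k = As * ε k + (1 / 2 : ℝ) * p k + (1 / 2 : ℝ) * q k := by
      intro k _; rw [hA k]; linear_combination ((p k + q k) / 2) * hε2 k
    rw [Finset.sum_congr rfl h]; simp only [Finset.sum_add_distrib, ← Finset.mul_sum]; rw [hcount]; ring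
  have hsumu : ∑ k, ε k * u k = 2 * us + ((∑ k, p k) - (∑ k, q k)) / 2 := by
    have h : ∀ k ∈ Finset.univ, ε k * u k = us * ε k + (1 / 2 : ℝ) * p k + (-(1 / 2) : ℝ) * q k := by
      intro k _; rw [hu k]; linear_combination ((p k - q k) / 2) * hε2 k
    rw [Finset.sum_congr rfl h]; simp only [Finset.sum_add_distrib, ← Finset.mul_sum]; rw [hcount]; ring
  set c₁ : ℝ := ((∑ k, p k) + (∑ k, q k)) / 4 with hc1
  set c₂ : ℝ := ((∑ k, p k) - (∑ k, q k)) / 4 with hc2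
  have hAt : ∀ k, A k - Ab = ε k * (p k + q k) / 2 - c₁ := by
    intro k; rw [hA k, hAb, hsumA]; ring
  have hut : ∀ k, u k - ub = ε k * (p k - q k) / 2 - c₂ := by
    intro k; rw [hu k, hub, hsumu]; ring
  have eSA : (∑ k, ε k * (A k - Ab) ^ 2) = ((-1 : ℝ) * c₁) * (∑ k, q k) + ((-1 : ℝ) * c₁) * (∑ k, p k) + ((1 : ℝ) * c₁ ^ 2) * (∑ k, ε k) + (((1 : ℝ) / 4)) * (∑ k, ε k * q k ^ 2) + (((1 : ℝ) / 4)) * (∑ k, ε k * p k ^ 2) := by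
    have h : ∀ k ∈ Finset.univ, ε k * (A k - Ab) ^ 2 = ((-1 : ℝ) * c₁) * (q k) + ((-1 : ℝ) * c₁) * (p k) + ((1 : ℝ) * c₁ ^ 2) * (ε k) + (((1 : ℝ) / 4)) * (ε k * q k ^ 2) + (((1 : ℝ) / 4)) * (ε k * p k ^ 2) := by
      intro k _
      simp only [hAt k]
      linear_combination (((1 : ℝ) / 4) * ε k * p k ^ 2 + ((1 : ℝ) / 4) * ε k * q k ^ 2 + (-1 : ℝ) * p k * c₁ + (-1 : ℝ) * q k * c₁) * hε2 k + (((1 : ℝ) / 2) * ε k ^ 3) * hcross k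
    rw [Finset.sum_congr rfl h]
    simp only [Finset.sum_add_distrib, ← Finset.mul_sum]
  have eSu : (∑ k, ε k * (u k - ub) ^ 2) = ((1 : ℝ) * c₂) * (∑ k, q k) + ((-1 : ℝ) * c₂) * (∑ k, p k) + ((1 : ℝ) * c₂ ^ 2) * (∑ k, ε k) + (((1 : ℝ) / 4)) * (∑ k, ε k * q k ^ 2) + (((1 : ℝ) / 4)) * (∑ k, ε k * p k ^ 2) := by
    have h : ∀ k ∈ Finset.univ, ε k * (u k - ub) ^ 2 = ((1 : ℝ) * c₂) * (q k) + ((-1 : ℝ) * c₂) * (p k) + ((1 : ℝ) * c₂ ^ 2) * (ε k) + (((1 : ℝ) / 4)) * (ε k * q k ^ 2) + (((1 : ℝ) / 4)) * (ε k * p k ^ 2) := by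
      intro k _
      simp only [hut k]
      linear_combination (((1 : ℝ) / 4) * ε k * p k ^ 2 + ((1 : ℝ) / 4) * ε k * q k ^ 2 + (-1 : ℝ) * p k * c₂ + (1 : ℝ) * q k * c₂) * hε2 k + (((-1 : ℝ) / 2) * ε k ^ 3) * hcross k
    rw [Finset.sum_congr rfl h]
    simp only [Finset.sum_add_distrib, ← Finset.mul_sum]
  have eSAu : (∑ k, ε k * (A k - Ab) * (u k - ub)) = (((1 : ℝ) / 2) * c₁ + ((-1 : ℝ) / 2) * c₂) * (∑ k, q k) + (((-1 : ℝ) / 2) * c₁ + ((-1 : ℝ) / 2) * c₂) * (∑ k, p k) + ((1 : ℝ) * c₁ * c₂) * (∑ k, ε k) + (((-1 : ℝ) / 4)) * (∑ k, ε k * q k ^ 2) + (((1 : ℝ) / 4)) * (∑ k, ε k * p k ^ 2) := by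
    have h : ∀ k ∈ Finset.univ, ε k * (A k - Ab) * (u k - ub) = (((1 : ℝ) / 2) * c₁ + ((-1 : ℝ) / 2) * c₂) * (q k) + (((-1 : ℝ) / 2) * c₁ + ((-1 : ℝ) / 2) * c₂) * (p k) + ((1 : ℝ) * c₁ * c₂) * (ε k) + (((-1 : ℝ) / 4)) * (ε k * q k ^ 2) + (((1 : ℝ) / 4)) * (ε k * p k ^ 2) := by
      intro k _
      simp only [hAt k, hut k]
      linear_combination (((1 : ℝ) / 4) * ε k * p k ^ 2 + ((-1 : ℝ) / 4) * ε k * q k ^ 2 + ((-1 : ℝ) / 2) * p k * c₁ + ((-1 : ℝ) / 2) * p k * c₂ + ((1 : ℝ) / 2) * q k * c₁ + ((-1 : ℝ) / 2) * q k * c₂) * hε2 k + (0) * hcross k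
    rw [Finset.sum_congr rfl h]
    simp only [Finset.sum_add_distrib, ← Finset.mul_sum]
  have eM30 : (∑ k, ε k * (A k - Ab) ^ 3) = (((3 : ℝ) / 2) * c₁ ^ 2) * (∑ k, q k) + (((1 : ℝ) / 8)) * (∑ k, q k ^ 3) + (((3 : ℝ) / 2) * c₁ ^ 2) * (∑ k, p k) + (((1 : ℝ) / 8)) * (∑ k, p k ^ 3) + ((-1 : ℝ) * c₁ ^ 3) * (∑ k, ε k) + (((-3 : ℝ) / 4) * c₁) * (∑ k, ε k * q k ^ 2) + (((-3 : ℝ) / 4) * c₁) * (∑ k, ε k * p k ^ 2) := by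
    have h : ∀ k ∈ Finset.univ, ε k * (A k - Ab) ^ 3 = (((3 : ℝ) / 2) * c₁ ^ 2) * (q k) + (((1 : ℝ) / 8)) * (q k ^ 3) + (((3 : ℝ) / 2) * c₁ ^ 2) * (p k) + (((1 : ℝ) / 8)) * (p k ^ 3) + ((-1 : ℝ) * c₁ ^ 3) * (ε k) + (((-3 : ℝ) / 4) * c₁) * (ε k * q k ^ 2) + (((-3 : ℝ) / 4) * c₁) * (ε k * p k ^ 2) := by
      intro k _
      simp only [hAt k]
      linear_combination (((1 : ℝ) / 8) * ε k ^ 2 * p k ^ 3 + ((1 : ℝ) / 8) * ε k ^ 2 * q k ^ 3 + ((-3 : ℝ) / 4) * ε k * p k ^ 2 * c₁ + ((-3 : ℝ) / 4) * ε k * q k ^ 2 * c₁ + ((1 : ℝ) / 8) * p k ^ 3 + ((3 : ℝ) / 2) * p k * c₁ ^ 2 + ((1 : ℝ) / 8) * q k ^ 3 + ((3 : ℝ) / 2) * q k * c₁ ^ 2) * hε2 k + (((3 : ℝ) / 8) * ε k ^ 4 * p k + ((3 : ℝ) / 8) * ε k ^ 4 * q k + ((-3 : ℝ) / 2) * ε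 k ^ 3 * c₁) * hcross k
    rw [Finset.sum_congr rfl h]
    simp only [Finset.sum_add_distrib, ← Finset.mul_sum]
  have eM21 : (∑ k, ε k * (A k - Ab) ^ 2 * (u k - ub)) = (((-1 : ℝ) / 2) * c₁ ^ 2 + (1 : ℝ) * c₁ * c₂) * (∑ k, q k) + (((-1 : ℝ) / 8)) * (∑ k, q k ^ 3) + (((1 : ℝ) / 2) * c₁ ^ 2 + (1 : ℝ) * c₁ * c₂) * (∑ k, p k) + (((1 : ℝ) / 8)) * (∑ k, p k ^ 3) + ((-1 : ℝ) * c₁ ^ 2 * c₂) * (∑ k, ε k) + (((1 : ℝ) / 2) * c₁ + ((-1 : ℝ) / 4) * c₂) * (∑ k, ε k * q k ^ 2) + (((-1 : ℝ) / 2) * c₁ + ((-1 : ℝ) / 4) * c₂) * (∑ k, ε k * p k ^ 2) := by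
    have h : ∀ k ∈ Finset.univ, ε k * (A k - Ab) ^ 2 * (u k - ub) = (((-1 : ℝ) / 2) * c₁ ^ 2 + (1 : ℝ) * c₁ * c₂) * (q k) + (((-1 : ℝ) / 8)) * (q k ^ 3) + (((1 : ℝ) / 2) * c₁ ^ 2 + (1 : ℝ) * c₁ * c₂) * (p k) + (((1 : ℝ) / 8)) * (p k ^ 3) + ((-1 : ℝ) * c₁ ^ 2 * c₂) * (ε k) + (((1 : ℝ) / 2) * c₁ + ((-1 : ℝ) / 4) * c₂) * (ε k * q k ^ 2) + (((-1 : ℝ) / 2) * c₁ + ((-1 : ℝ) / 4) * c₂) * (ε k * p k ^ 2) := by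
      intro k _
      simp only [hAt k, hut k]
      linear_combination (((1 : ℝ) / 8) * ε k ^ 2 * p k ^ 3 + ((-1 : ℝ) / 8) * ε k ^ 2 * q k ^ 3 + ((-1 : ℝ) / 2) * ε k * p k ^ 2 * c₁ + ((-1 : ℝ) / 4) * ε k * p k ^ 2 * c₂ + ((1 : ℝ) / 2) * ε k * q k ^ 2 * c₁ + ((-1 : ℝ) / 4) * ε k * q k ^ 2 * c₂ + ((1 : ℝ) / 8) * p k ^ 3 + ((1 : ℝ) / 2) * p k * c₁ ^ 2 + (1 : ℝ) * p k * c₁ * c₂ + ((-1 : ℝ) / 8) * q k ^ 3 + ((-1 : ℝ) / 2) * q k * c₁ ^ 2 + (1 : ℝ) * q k * c₁ * c₂) * hε2 k + (((1 : ℝ) / 8) * ε k ^ 4 * p k + ((-1 : ℝ) / 8) * ε k ^ 4 * q k + ((-1 : ℝ) / 2) * ε k ^ 3 * c₂) * hcross k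
    rw [Finset.sum_congr rfl h]
    simp only [Finset.sum_add_distrib, ← Finset.mul_sum]
  have eM12 : (∑ k, ε k * (A k - Ab) * (u k - ub) ^ 2) = ((-1 : ℝ) * c₁ * c₂ + ((1 : ℝ) / 2) * c₂ ^ 2) * (∑ k, q k) + (((1 : ℝ) / 8)) * (∑ k, q k ^ 3) + ((1 : ℝ) * c₁ * c₂ + ((1 : ℝ) / 2) * c₂ ^ 2) * (∑ k, p k) + (((1 : ℝ) / 8)) * (∑ k, p k ^ 3) + ((-1 : ℝ) * c₁ * c₂ ^ 2) * (∑ k, ε k) + (((-1 : ℝ) / 4) * c₁ + ((1 : ℝ) / 2) * c₂) * (∑ k, ε k * q k ^ 2) + (((-1 : ℝ) / 4) * c₁ + ((-1 : ℝ) / 2) * c₂) * (∑ k, ε k * p k ^ 2) := by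
    have h : ∀ k ∈ Finset.univ, ε k * (A k - Ab) * (u k - ub) ^ 2 = ((-1 : ℝ) * c₁ * c₂ + ((1 : ℝ) / 2) * c₂ ^ 2) * (q k) + (((1 : ℝ) / 8)) * (q k ^ 3) + ((1 : ℝ) * c₁ * c₂ + ((1 : ℝ) / 2) * c₂ ^ 2) * (p k) + (((1 : ℝ) / 8)) * (p k ^ 3) + ((-1 : ℝ) * c₁ * c₂ ^ 2) * (ε k) + (((-1 : ℝ) / 4) * c₁ + ((1 : ℝ) / 2) * c₂) * (ε k * q k ^ 2) + (((-1 : ℝ) / 4) * c₁ + ((-1 : ℝ) / 2) * c₂) * (ε k * p k ^ 2) := by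
      intro k _
      simp only [hAt k, hut k]
      linear_combination (((1 : ℝ) / 8) * ε k ^ 2 * p k ^ 3 + ((1 : ℝ) / 8) * ε k ^ 2 * q k ^ 3 + ((-1 : ℝ) / 4) * ε k * p k ^ 2 * c₁ + ((-1 : ℝ) / 2) * ε k * p k ^ 2 * c₂ + ((-1 : ℝ) / 4) * ε k * q k ^ 2 * c₁ + ((1 : ℝ) / 2) * ε k * q k ^ 2 * c₂ + ((1 : ℝ) / 8) * p k ^ 3 + (1 : ℝ) * p k * c₁ * c₂ + ((1 : ℝ) / 2) * p k * c₂ ^ 2 + ((1 : ℝ) / 8) * q k ^ 3 + (-1 : ℝ) * q k * c₁ * c₂ + ((1 : ℝ) / 2) * q k * c₂ ^ 2) * hε2 k + (((-1 : ℝ) / 8) * ε k ^ 4 * p k + ((-1 : ℝ) / 8) * ε k ^ 4 * q k + ((1 : ℝ) / 2) * ε k ^ 3 * c₁) * hcross k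
    rw [Finset.sum_congr rfl h]
    simp only [Finset.sum_add_distrib, ← Finset.mul_sum]
  have eM03 : (∑ k, ε k * (u k - ub) ^ 3) = (((-3 : ℝ) / 2) * c₂ ^ 2) * (∑ k, q k) + (((-1 : ℝ) / 8)) * (∑ k, q k ^ 3) + (((3 : ℝ) / 2) * c₂ ^ 2) * (∑ k, p k) + (((1 : ℝ) / 8)) * (∑ k, p k ^ 3) + ((-1 : ℝ) * c₂ ^ 3) * (∑ k, ε k) + (((-3 : ℝ) / 4) * c₂) * (∑ k, ε k * q k ^ 2) + (((-3 : ℝ) / 4) * c₂) * (∑ k, ε k * p k ^ 2) := by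
    have h : ∀ k ∈ Finset.univ, ε k * (u k - ub) ^ 3 = (((-3 : ℝ) / 2) * c₂ ^ 2) * (q k) + (((-1 : ℝ) / 8)) * (q k ^ 3) + (((3 : ℝ) / 2) * c₂ ^ 2) * (p k) + (((1 : ℝ) / 8)) * (p k ^ 3) + ((-1 : ℝ) * c₂ ^ 3) * (ε k) + (((-3 : ℝ) / 4) * c₂) * (ε k * q k ^ 2) + (((-3 : ℝ) / 4) * c₂) * (ε k * p k ^ 2) := by
      intro k _
      simp only [hut k]
      linear_combination (((1 : ℝ) / 8) * ε k ^ 2 * p k ^ 3 + ((-1 : ℝ) / 8) * ε k ^ 2 * q k ^ 3 + ((-3 : ℝ) / 4) * ε k * p k ^ 2 * c₂ + ((-3 : ℝ) / 4) * ε k * q k ^ 2 * c₂ + ((1 : ℝ) / 8) * p k ^ 3 + ((3 : ℝ) / 2) * p k * c₂ ^ 2 + ((-1 : ℝ) / 8) * q k ^ 3 + ((-3 : ℝ) / 2) * q k * c₂ ^ 2) * hε2 k + (((-3 : ℝ) / 8) * ε k ^ 4 * p k + ((3 : ℝ) / 8) * ε k ^ 4 * q k + ((3 : ℝ) / 2)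 * ε k ^ 3 * c₂) * hcross k
    rw [Finset.sum_congr rfl h]
    simp only [Finset.sum_add_distrib, ← Finset.mul_sum]
  have eM22 : (∑ k, ε k * (A k - Ab) ^ 2 * (u k - ub) ^ 2) = ((1 : ℝ) * c₁ ^ 2 * c₂ + (-1 : ℝ) * c₁ * c₂ ^ 2) * (∑ k, q k) + (((-1 : ℝ) / 4) * c₁ + ((1 : ℝ) / 4) * c₂) * (∑ k, q k ^ 3) + ((-1 : ℝ) * c₁ ^ 2 * c₂ + (-1 : ℝ) * c₁ * c₂ ^ 2) * (∑ k, p k) + (((-1 : ℝ) / 4) * c₁ + ((-1 : ℝ) / 4) * c₂) * (∑ k, p k ^ 3) + ((1 : ℝ) * c₁ ^ 2 * c₂ ^ 2) * (∑ k, ε k) + (((1 : ℝ) / 4) * c₁ ^ 2 + (-1 : ℝ) * c₁ * c₂ + ((1 : ℝ) / 4) * c₂ ^ 2) * (∑ k, ε k * q k ^ 2) + (((1 : ℝ) / 16)) * (∑ k, ε k * q k ^ 4) + (((1 : ℝ) / 4) * c₁ ^ 2 + (1 : ℝ) * c₁ * c₂ + ((1 : ℝ) / 4) * c₂ ^ 2)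 * (∑ k, ε k * p k ^ 2) + (((1 : ℝ) / 16)) * (∑ k, ε k * p k ^ 4) := by
    have h : ∀ k ∈ Finset.univ, ε k * (A k - Ab) ^ 2 * (u k - ub) ^ 2 = ((1 : ℝ) * c₁ ^ 2 * c₂ + (-1 : ℝ) * c₁ * c₂ ^ 2) * (q k) + (((-1 : ℝ) / 4) * c₁ + ((1 : ℝ) / 4) * c₂) * (q k ^ 3) + ((-1 : ℝ) * c₁ ^ 2 * c₂ + (-1 : ℝ) * c₁ * c₂ ^ 2) * (p k) + (((-1 : ℝ) / 4) * c₁ + ((-1 : ℝ) / 4) * c₂) * (p k ^ 3) + ((1 : ℝ) * c₁ ^ 2 * c₂ ^ 2) * (ε k) + (((1 : ℝ) / 4) * c₁ ^ 2 + (-1 : ℝ) * c₁ * c₂ + ((1 : ℝ) / 4) * c₂ ^ 2) * (ε k * q k ^ 2) + (((1 : ℝ) / 16)) * (ε k * q k ^ 4) + (((1 : ℝ) / 4) * c₁ ^ 2 + (1 : ℝ) * c₁ * c₂ + ((1 : ℝ) / 4) * c₂ ^ 2) * (ε k * p k ^ 2) + (((1 : ℝ) / 16)) * (ε k * p k ^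 4) := by
      intro k _
      simp only [hAt k, hut k]
      linear_combination (((1 : ℝ) / 16) * ε k ^ 3 * p k ^ 4 + ((1 : ℝ) / 16) * ε k ^ 3 * q k ^ 4 + ((-1 : ℝ) / 4) * ε k ^ 2 * p k ^ 3 * c₁ + ((-1 : ℝ) / 4) * ε k ^ 2 * p k ^ 3 * c₂ + ((-1 : ℝ) / 4) * ε k ^ 2 * q k ^ 3 * c₁ + ((1 : ℝ) / 4) * ε k ^ 2 * q k ^ 3 * c₂ + ((1 : ℝ) / 16) * ε k * p k ^ 4 + ((1 : ℝ) / 4) * ε k * p k ^ 2 * c₁ ^ 2 + (1 : ℝ) * ε k * p k ^ 2 * c₁ * c₂ + ((1 : ℝ) / 4) * ε k * p k ^ 2 * c₂ ^ 2 + ((1 : ℝ) / 16) * ε k * q k ^ 4 + ((1 : ℝ) / 4) * ε k * q k ^ 2 * c₁ ^ 2 + (-1 : ℝ) * ε k * q k ^ 2 * c₁ * c₂ + ((1 : ℝ) / 4) * ε k * q k ^ 2 * c₂ ^ 2 + ((-1 : ℝ) / 4) * p k ^ 3 * c₁ + ((-1 : ℝ) / 4) * p k ^ 3 * c₂ + (-1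 : ℝ) * p k * c₁ ^ 2 * c₂ + (-1 : ℝ) * p k * c₁ * c₂ ^ 2 + ((-1 : ℝ) / 4) * q k ^ 3 * c₁ + ((1 : ℝ) / 4) * q k ^ 3 * c₂ + (1 : ℝ) * q k * c₁ ^ 2 * c₂ + (-1 : ℝ) * q k * c₁ * c₂ ^ 2) * hε2 k + (((-1 : ℝ) / 8) * ε k ^ 5 * p k * q k + ((1 : ℝ) / 4) * ε k ^ 4 * p k * c₁ + ((-1 : ℝ) / 4) * ε k ^ 4 * p k * c₂ + ((1 : ℝ) / 4) * ε k ^ 4 * q k * c₁ + ((1 : ℝ) / 4) * ε k ^ 4 * q k * c₂ + ((-1 : ℝ) / 2) * ε k ^ 3 * c₁ ^ 2 + ((1 : ℝ) / 2) * ε k ^ 3 * c₂ ^ 2) * hcross k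
    rw [Finset.sum_congr rfl h]
    simp only [Finset.sum_add_distrib, ← Finset.mul_sum]
  have eM04 : (∑ k, ε k * (u k - ub) ^ 4) = ((2 : ℝ) * c₂ ^ 3) * (∑ k, q k) + (((1 : ℝ) / 2) * c₂) * (∑ k, q k ^ 3) + ((-2 : ℝ) * c₂ ^ 3) * (∑ k, p k) + (((-1 : ℝ) / 2) * c₂) * (∑ k, p k ^ 3) + ((1 : ℝ) * c₂ ^ 4) * (∑ k, ε k) + (((3 : ℝ) / 2) * c₂ ^ 2) * (∑ k, ε k * q k ^ 2) + (((1 : ℝ) / 16)) * (∑ k, ε k * q k ^ 4) + (((3 : ℝ) / 2) * c₂ ^ 2) * (∑ k, ε k * p k ^ 2) + (((1 : ℝ) / 16)) * (∑ k, ε k * p k ^ 4) := by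
    have h : ∀ k ∈ Finset.univ, ε k * (u k - ub) ^ 4 = ((2 : ℝ) * c₂ ^ 3) * (q k) + (((1 : ℝ) / 2) * c₂) * (q k ^ 3) + ((-2 : ℝ) * c₂ ^ 3) * (p k) + (((-1 : ℝ) / 2) * c₂) * (p k ^ 3) + ((1 : ℝ) * c₂ ^ 4) * (ε k) + (((3 : ℝ) / 2) * c₂ ^ 2) * (ε k * q k ^ 2) + (((1 : ℝ) / 16)) * (ε k * q k ^ 4) + (((3 : ℝ) / 2) * c₂ ^ 2) * (ε k * p k ^ 2) + (((1 : ℝ) / 16)) * (ε k * p k ^ 4) := by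
      intro k _
      simp only [hut k]
      linear_combination (((1 : ℝ) / 16) * ε k ^ 3 * p k ^ 4 + ((1 : ℝ) / 16) * ε k ^ 3 * q k ^ 4 + ((-1 : ℝ) / 2) * ε k ^ 2 * p k ^ 3 * c₂ + ((1 : ℝ) / 2) * ε k ^ 2 * q k ^ 3 * c₂ + ((1 : ℝ) / 16) * ε k * p k ^ 4 + ((3 : ℝ) / 2) * ε k * p k ^ 2 * c₂ ^ 2 + ((1 : ℝ) / 16) * ε k * q k ^ 4 + ((3 : ℝ) / 2) * ε k * q k ^ 2 * c₂ ^ 2 + ((-1 : ℝ) / 2) * p k ^ 3 * c₂ + (-2 : ℝ) * p k * c₂ ^ 3 + ((1 : ℝ) / 2) * q k ^ 3 * c₂ + (2 : ℝ) * q k * c₂ ^ 3) * hε2 k + (((-1 : ℝ) / 4) * ε k ^ 5 * p k ^ 2 + ((3 : ℝ) / 8) * ε k ^ 5 * p k * q k + ((-1 : ℝ) / 4) * ε k ^ 5 * q k ^ 2 + ((3 : ℝ) / 2) * ε k ^ 4 * p k * c₂ + ((-3 : ℝ) / 2) * ε k ^ 4 * q k * c₂ + (-3 : ℝ) * ε k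 ^ 3 * c₂ ^ 2) * hcross k
    rw [Finset.sum_congr rfl h]
    simp only [Finset.sum_add_distrib, ← Finset.mul_sum]
  rw [eM21] at hP1
  rw [eM12] at hP2
  rw [eM03] at hP4
  rw [eSA, eSu, eSAu, eM22, eM04]
  rw [hcount] at hP1 hP2 hP4 ⊢
  simp only [hc1, hc2] at hP1 hP2 hP4 ⊢
  have key := cross_G0_nonneg ε p q hε hp hq (∑ k, p k) (∑ k, q k) (∑ k, ε k * p k ^ 2) (∑ k, ε k * q k ^ 2)
    (∑ k, p k ^ 3) (∑ k, q k ^ 3)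
    ((∑ k, p k ^ 3) - 3 / 2 * (∑ k, p k) * (∑ k, ε k * p k ^ 2) + 1 / 2 * (∑ k, p k) ^ 3)
    rfl rfl rfl rfl rfl rfl (by ring)
    (by linear_combination (-6) * hP1 + (-2) * hP4)
    (by linear_combination (2 : ℝ) * hP1 + (4 : ℝ) * hP2 + (2 : ℝ) * hP4)
    (by linear_combination (4 : ℝ) * hP1 + (4 : ℝ) * hP2)
  convert key using 1
  ring


/-! ### Appendix (prover 2, generation 9, same seat): the light-cone dictionary for ARBITRARY configurations

No cross hypothesis and no sign hypothesis below: for any finite family of signs `ε_k` and centred coordinates `Ã_k, ũ_k`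
(light-cone coordinates `P̃ = Ã + ũ`, `M̃ = Ã − ũ`), (i) `G₀ = Q₂ + Q₄` equals the light-cone expression
`−(3/4)Σε P̃M̃(P̃−M̃)² − (1/4)m₂₀m₀₂ − (1/2)m₁₁² + (3/8)m₁₁(m₂₀+m₀₂)` of note Lemma 2.1(c), and (ii) the three purity sums
`ΣεÃ²ũ, ΣεÃũ², Σεũ³` vanish iff the four cubic light-cone moments `m₃₀, m₂₁, m₁₂, m₀₃` are equal (note Lemma 2.1(b)). -/

/-- LIGHT-CONE FORM of the charge-zero functional (note Lemma 2.1(c)): an identity of finite sums, no hypothesis. [folklore] -/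
theorem lightCone_G0_eq {ι : Type*} [Fintype ι] (ε a w : ι → ℝ) :
    1 / 2 * (∑ k, ε k * a k ^ 2) * (∑ k, ε k * w k ^ 2) + (∑ k, ε k * a k * w k) ^ 2
        - 3 * (∑ k, ε k * a k ^ 2 * w k ^ 2) + (3 * (∑ k, ε k * w k ^ 4) - 3 / 2 * (∑ k, ε k * w k ^ 2) ^ 2)
      = -(3 / 4) * (∑ k, ε k * ((a k + w k) * (a k - w k) * ((a k + w k) - (a k - w k)) ^ 2))
        - 1 / 4 * (∑ k, ε k * (a k + w k) ^ 2) * (∑ k, ε k * (a k - w k) ^ 2)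
        - 1 / 2 * (∑ k, ε k * ((a k + w k) * (a k - w k))) ^ 2
        + 3 / 8 * (∑ k, ε k * ((a k + w k) * (a k - w k)))
            * ((∑ k, ε k * (a k + w k) ^ 2) + (∑ k, ε k * (a k - w k) ^ 2)) := by
  have h20 : ∑ k, ε k * (a k + w k) ^ 2
      = (∑ k, ε k * a k ^ 2) + 2 * (∑ k, ε k * a k * w k) + (∑ k, ε k * w k ^ 2) := by
    rw [Finset.mul_sum, ← Finset.sum_add_distrib, ← Finset.sum_add_distrib]
    exact Finset.sum_congr rfl (fun k _ => by ring)
  have h02 : ∑ k, ε k * (a k - w k) ^ 2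
      = (∑ k, ε k * a k ^ 2) - 2 * (∑ k, ε k * a k * w k) + (∑ k, ε k * w k ^ 2) := by
    rw [Finset.mul_sum, ← Finset.sum_sub_distrib, ← Finset.sum_add_distrib]
    exact Finset.sum_congr rfl (fun k _ => by ring)
  have h11 : ∑ k, ε k * ((a k + w k) * (a k - w k)) = (∑ k, ε k * a k ^ 2) - (∑ k, ε k * w k ^ 2) := by
    rw [← Finset.sum_sub_distrib]
    exact Finset.sum_congr rfl (fun k _ => by ring)
  have hT4 : ∑ k, ε k * ((a k + w k) * (a k - w k) * ((a k + w k) - (a k - w k)) ^ 2)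
      = 4 * (∑ k, ε k * a k ^ 2 * w k ^ 2) - 4 * (∑ k, ε k * w k ^ 4) := by
    rw [Finset.mul_sum, Finset.mul_sum, ← Finset.sum_sub_distrib]
    exact Finset.sum_congr rfl (fun k _ => by ring)
  rw [h20, h02, h11, hT4]
  ring

/-- PURITY IN LIGHT-CONE FORM (note Lemma 2.1(b)): the purity sums `ΣεÃ²ũ`, `ΣεÃũ²`, `Σεũ³` all vanish iff the four cubic
light-cone moments `Σε P̃³, Σε P̃²M̃, Σε P̃M̃², Σε M̃³` are equal (`P̃ = Ã+ũ`, `M̃ = Ã−ũ`); no hypothesis. [folklore] -/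
theorem purity_iff_lightCone_cubic_moments_eq {ι : Type*} [Fintype ι] (ε a w : ι → ℝ) :
    ((∑ k, ε k * a k ^ 2 * w k) = 0 ∧ (∑ k, ε k * a k * w k ^ 2) = 0 ∧ (∑ k, ε k * w k ^ 3) = 0)
      ↔ ((∑ k, ε k * (a k + w k) ^ 3) = (∑ k, ε k * (a k + w k) ^ 2 * (a k - w k))
          ∧ (∑ k, ε k * (a k + w k) ^ 2 * (a k - w k)) = (∑ k, ε k * (a k + w k) * (a k - w k) ^ 2)
          ∧ (∑ k, ε k * (a k + w k) * (a k - w k) ^ 2) = (∑ k, ε k * (a k - w k) ^ 3)) := by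
  have e30 : ∑ k, ε k * (a k + w k) ^ 3 = (∑ k, ε k * a k ^ 3) + 3 * (∑ k, ε k * a k ^ 2 * w k)
      + 3 * (∑ k, ε k * a k * w k ^ 2) + (∑ k, ε k * w k ^ 3) := by
    rw [Finset.mul_sum, Finset.mul_sum, ← Finset.sum_add_distrib, ← Finset.sum_add_distrib, ← Finset.sum_add_distrib]
    exact Finset.sum_congr rfl (fun k _ => by ring)
  have e21 : ∑ k, ε k * (a k + w k) ^ 2 * (a k - w k) = (∑ k, ε k * a k ^ 3) + (∑ k, ε k * a k ^ 2 * w k)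
      - (∑ k, ε k * a k * w k ^ 2) - (∑ k, ε k * w k ^ 3) := by
    rw [← Finset.sum_add_distrib, ← Finset.sum_sub_distrib, ← Finset.sum_sub_distrib]
    exact Finset.sum_congr rfl (fun k _ => by ring)
  have e12 : ∑ k, ε k * (a k + w k) * (a k - w k) ^ 2 = (∑ k, ε k * a k ^ 3) - (∑ k, ε k * a k ^ 2 * w k)
      - (∑ k, ε k * a k * w k ^ 2) + (∑ k, ε k * w k ^ 3) := by
    rw [← Finset.sum_sub_distrib, ← Finset.sum_sub_distrib, ← Finset.sum_add_distrib]
    exact Finset.sum_congr rfl (fun k _ => by ring)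
  have e03 : ∑ k, ε k * (a k - w k) ^ 3 = (∑ k, ε k * a k ^ 3) - 3 * (∑ k, ε k * a k ^ 2 * w k)
      + 3 * (∑ k, ε k * a k * w k ^ 2) - (∑ k, ε k * w k ^ 3) := by
    rw [Finset.mul_sum, Finset.mul_sum, ← Finset.sum_sub_distrib, ← Finset.sum_add_distrib, ← Finset.sum_sub_distrib]
    exact Finset.sum_congr rfl (fun k _ => by ring)
  rw [e30, e21, e12, e03]
  constructor
  · rintro ⟨h1, h2, h3⟩
    refine ⟨?_, ?_, ?_⟩ <;> linarith
  · rintro ⟨h1, h2, h3⟩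
    refine ⟨?_, ?_, ?_⟩ <;> linarith

end Literature.AlgebraicGeometry.HodgeTheory.WeilClassTestNullCone
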